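import Summits.Schanuel.Schanuel.Theses.RigidCore

/-!
# Route `RigidCore`, assembly item `Assembly` (stmt-Schanuel-0976)

`MinimalCounterexampleInAcl → AclSubsetLogFreeCore → SchanuelOnLogFreeCore → Schanuel`:
the three localisation cruxes of route `Schanuel/RigidCore` decide Schanuel's conjecture.

Proof (bookkeeping, self-contained; the same strong induction as the route's deciding theorem
`Summit.Schanuel.Schanuel.Theses.RigidCore.closes`): `Schanuel` unfolds to
`∀ n z, LinearIndependent ℚ z → n ≤ trdeg ℚ ℚ(z, exp z)`. Strong induction on the rank `n`: if
`trdeg < n` for some `ℚ`-linearly independent `z : Fin n → ℂ`, then the induction hypothesis is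
verbatim `SchanuelRank r` for every `r < n` (`Literature.NumberTheory.Transcendental.SchanuelRank`
is the `n`-slice of `Literature.Periods.SchanuelConjecture`), so (S*) `MinimalCounterexampleInAcl`
puts every coordinate `z i` in a finite `∅`-definable subset of `ℂ_exp`, (A) `AclSubsetLogFreeCore`
moves it into the log-free core `C_EA`, and (R) `SchanuelOnLogFreeCore` gives `n ≤ trdeg` —
contradiction.

## References

* [Kirby2010] J. Kirby, *Exponential algebraicity in exponential fields*, Bull. LMS 42 (2010),
  arXiv:0810.4285, Prop. 7.2 / §7 (the localisation pattern: essential counterexamples lie in a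
  closure operator's `∅`-closure).
-/

namespace Summit.Schanuel.Schanuel.Theorems

/-- **Item stmt-Schanuel-0976 (`RigidCore.Assembly`), proved**: the three localisation cruxes
(S*) `MinimalCounterexampleInAcl`, (A) `AclSubsetLogFreeCore`, (R) `SchanuelOnLogFreeCore` imply
`Schanuel`.  Strong induction on the rank `n`: a first failure at rank `n` (all `SchanuelRank r`,
`r < n`, hold by the induction hypothesis) has every coordinate in `acl^{ℂ_exp}(∅)` by (S*), hence
in the log-free core `C_EA` by (A), where (R) gives `n ≤ trdeg` — contradiction. [folklore] -/
theorem rigidCore_assembly_proof :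
    Summit.Schanuel.Schanuel.Theses.RigidCore.Assembly := by
  unfold Summit.Schanuel.Schanuel.Theses.RigidCore.Assembly
  intro hS hA hR
  show ∀ (n : ℕ) (z : Fin n → ℂ), LinearIndependent ℚ z →
    (n : Cardinal) ≤ Algebra.trdeg ℚ
      ↥(IntermediateField.adjoin ℚ (Set.range z ∪ Set.range (Complex.exp ∘ z)))
  intro n
  induction n using Nat.strong_induction_on with
  | _ n ih =>
    intro z hz
    by_contra hlt
    have hlt' : Algebra.trdeg ℚ
        ↥(IntermediateField.adjoin ℚ (Set.range z ∪ Set.range (Complex.exp ∘ z))) <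
          (n : Cardinal) :=
      lt_of_not_ge hlt
    have hrank : ∀ r < n, Literature.NumberTheory.Transcendental.SchanuelRank r :=
      fun r hr => ih r hr
    have hmem := fun i => hA (z i) (hS n z hz hlt' hrank i)
    exact hlt (hR n z hmem hz)

end Summit.Schanuel.Schanuel.Theorems
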